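import Literature.Probability.Percolation.IsoradialAltArmLocality
import Literature.Probability.Percolation.IsoradialArmComparabilityProofs
import HarnessLib

/-!
# The vertex-disjoint arm events on isoradial graphs: locality, measurability, independence of
disjoint annuli, sub-multiplicativity

Proofs-only companion (theorems only; D-0026: no new definition, no new named fact) of
`Literature.Probability.Percolation.IsoradialArmComparability` — the named fact
`GrimmettManolescu2014_armComparability_one_two` (`T`: Grimmett–Manolescu, *Bond percolation on
isoradial graphs*, PTRF 159 (2014) 273–327 = arXiv:1204.0505, §8.1 Prop. (exp_transport) with
§8.2 Prop. (exp_equiv), `k ∈ {1, 2}`), which is stated on the arm events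
`RhombicEmbedding.embArmEvent κ r R` of `IsoradialPercolation` (sup-norm annulus
`{r - 2 ≤ ‖·‖_∞ ≤ R + 2}`, primal open walks / dual open walks, vertex-disjoint within each
colour, *every* colour sequence `κ`). The sibling file `IsoradialAltArmLocality` supplies, for
the cluster-separated alternating events `embAltArmEvent` of the sibling fact, the
measure-theoretic bookkeeping that every step of the printed §8 takes for granted ("The event
`H_M` depends only on the configuration inside `B_M`", §8.5.2; "iterated" comparisons over
nested scales, §8.3–8.5; independence of disjoint annuli in Kesten's and Nolin's arguments behind
Theorem (separation)); this file does the same for the events of `T`: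

* `IsoradialArmLocality.exists_walk_congr` — a walk of `H` all of whose steps are also edges of
  `H'` is (the support of) a walk of `H'` (elementary transfer).
* `RhombicEmbedding.determinedBy_embArmEvent` — **locality**: under `IsIsoradial`,
  `A_κ(r, R) = emb.embArmEvent κ r R` is determined by the states of the pairs of vertices drawn
  in the sup-norm shell `{r - 3 ≤ ‖·‖_∞ ≤ R + 3}`: the primal arms live in the vertex annulus
  `{r - 2 ≤ ‖z ·‖_∞ ≤ R + 2}` and use only pairs of it; the dual arms live in the face annulus
  `{r - 2 ≤ ‖c ·‖_∞ ≤ R + 2}` and their steps are read off edges of `G` whose endpoints are within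
  sup-norm distance `1` of those face centres (`abs_boxNorm_z_sub_boxNorm_c_le_one`). (The
  unconstrained "junk" walks of the non-matching colours in the definition of `embArmEvent` are
  replaced by trivial walks.)
* `RhombicEmbedding.measurableSet_embArmEvent` — **measurability** of `A_κ(r, R)`, every `κ`, on
  the class of the fact (preconnected, isoradial, rhombic tiling, BAP(ε)): a cylinder event of
  the finitely many pairs of vertices of the shell (`finite_setOf_boxNorm_z_le`). (For `k = 1` and
  countable `V` a different proof is `IsoradialArmExtension.measurableSet_embArmEvent_oneArm`.)
* `RhombicEmbedding.isoradialPercolation_real_embArmEvent_inter` — **independence of disjoint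
  annuli**: for `R₁ + 7 ≤ r₂`, `A_{κ₁}(r₁, R₁)` and `A_{κ₂}(r₂, R₂)` are independent under the
  canonical measure `P_G` (product measure, disjoint determining shells).
* `RhombicEmbedding.embArmProb_submult` — **sub-multiplicativity** (the elementary half of
  quasi-multiplicativity), every `κ`: for `r ≤ m`, `m + 7 ≤ m' ≤ R`,
  `P_G[A_κ(r, R)] ≤ P_G[A_κ(r, m)] · P_G[A_κ(m', R)]` (inclusions
  `embArmEvent_inter_subset_outer/inner` of `IsoradialArmComparabilityProofs`, then independence).

Nothing here uses the box-crossing property; the discharge of `T` remains blocked on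
`gm_boxCrossingBounds_uniform` and on the separation theorem / star–triangle transport (module
docstring of `IsoradialArmComparabilityProofs`).

## References

* G. R. Grimmett, I. Manolescu, *Bond percolation on isoradial graphs: criticality and
  universality*, PTRF 159 (2014) 273–327, arXiv:1204.0505: §3 (arm events), §8.5.2 (locality of
  `H_M`, `K_m`; iteration over scales).
* G. Grimmett, *Percolation*, 2nd ed. (1999), §2.2 (events depending on finitely many edges;
  independence), §11.2 (planar duality).
* H. Kesten, *Scaling relations for 2D-percolation*, Comm. Math. Phys. 109 (1987) 109–156;
  P. Nolin, *Near-critical percolation in two dimensions*, EJP 13 (2008), §3.4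
  (independence of disjoint annuli, quasi-multiplicativity).
-/

noncomputable section

open MeasureTheory

namespace Literature.Probability.Percolation

open LatticeModels Percolation

namespace IsoradialArmLocality

/-- **Transfer of a walk**: if every step of the walk `p` of `H` (an `H`-edge between two of its
vertices) is also an edge of `H'`, then `H'` has a walk with the same endpoints and the same
support. [folklore] -/
theorem exists_walk_congr {W : Type*} {H H' : SimpleGraph W} {u v : W} (p : H.Walk u v)
    (h : ∀ ⦃a b : W⦄, a ∈ p.support → b ∈ p.support → H.Adj a b → H'.Adj a b) :
    ∃ q : H'.Walk u v, q.support = p.support := by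
  induction p with
  | nil => exact ⟨SimpleGraph.Walk.nil, rfl⟩
  | @cons a b c hab p ih =>
    have hsub : ∀ x ∈ p.support, x ∈ (SimpleGraph.Walk.cons hab p).support := fun x hx => by
      rw [SimpleGraph.Walk.support_cons]; exact List.mem_cons_of_mem _ hx
    obtain ⟨q, hq⟩ := ih (fun x y hx hy hxy => h (hsub x hx) (hsub y hy) hxy)
    have hab' : H'.Adj a b :=
      h (SimpleGraph.Walk.start_mem_support _) (hsub b p.start_mem_support) hab
    exact ⟨SimpleGraph.Walk.cons hab' q, by
      rw [SimpleGraph.Walk.support_cons, SimpleGraph.Walk.support_cons, hq]⟩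

end IsoradialArmLocality

open IsoradialArmLocality

/-! ### Locality -/

section Determined

variable {V F : Type*} {G : SimpleGraph V} (emb : RhombicEmbedding G F)

/-- **Locality of the vertex-disjoint arm events.** Under `IsIsoradial`, for every colour
sequence `κ` the arm event `A_κ(r, R) = emb.embArmEvent κ r R` is determined by the states of
the pairs of vertices drawn in the sup-norm shell `{r - 3 ≤ ‖·‖_∞ ≤ R + 3}`: if two
configurations agree on those pairs, the primal arms of the one (open walks inside the vertex
annulus `{r - 2 ≤ ‖z ·‖_∞ ≤ R + 2}`) are open walks of the other, with the same supports, and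
likewise the dual arms (dual-open walks inside the face annulus `{r - 2 ≤ ‖c ·‖_∞ ≤ R + 2}`, whose
steps cross edges of `G` with endpoints within sup-norm distance `1` of those face centres,
`abs_boxNorm_z_sub_boxNorm_c_le_one`); vertex-disjointness within each colour is a statement
about supports. (Grimmett–Manolescu 2014, §8.5.2: arm and crossing events of an annulus "depend
only on the configuration inside" it; Grimmett 1999, §2.2.)
[cite: GrimmettManolescu2014Isoradial, §8.5.2 (locality of H_M, K_m and of the arm events)] -/
theorem _root_.Literature.Probability.LatticeModels.RhombicEmbedding.determinedBy_embArmEvent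
    (hiso : emb.IsIsoradial) {k : ℕ} (κ : Fin k → Bool) (r R : ℕ) :
    DeterminedBy (emb.embArmEvent κ r R)
      {e : Sym2 V | ∀ v ∈ e, (emb.z v).boxNorm ∈ Set.Icc ((r : ℝ) - 3) (R + 3)} := by
  set K : Set (Sym2 V) :=
    {e : Sym2 V | ∀ v ∈ e, (emb.z v).boxNorm ∈ Set.Icc ((r : ℝ) - 3) (R + 3)} with hK
  -- one direction suffices, by symmetry
  suffices aux : ∀ ω ω' : BondConfig V, ω ∩ K = ω' ∩ K →
      ω ∈ emb.embArmEvent κ r R → ω' ∈ emb.embArmEvent κ r R by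
    rw [determinedBy_iff]
    exact fun ω ω' h => ⟨aux ω ω' h, aux ω' ω h.symm⟩
  intro ω ω' h hω
  simp only [RhombicEmbedding.embArmEvent, Set.mem_setOf_eq] at hω ⊢
  obtain ⟨x, y, w, f, g, w', hprim, hdual, hdisjP, hdisjD⟩ := hω
  -- open edges between vertices of the annulus are the same for `ω` and `ω'`
  have hadjP : ∀ ⦃a b : V⦄, (emb.z a).boxNorm ∈ Set.Icc ((r : ℝ) - 2) (R + 2) →
      (emb.z b).boxNorm ∈ Set.Icc ((r : ℝ) - 2) (R + 2) →
      (openGraph ω).Adj a b → (openGraph ω').Adj a b := by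
    intro a b ha hb hab
    rw [Set.mem_Icc] at ha hb
    have hmem : s(a, b) ∈ K := by
      intro v hv
      rw [Set.mem_Icc]
      rcases Sym2.mem_iff.1 hv with rfl | rfl
      · exact ⟨by linarith [ha.1], by linarith [ha.2]⟩
      · exact ⟨by linarith [hb.1], by linarith [hb.2]⟩
    rw [openGraph_adj] at hab ⊢
    exact ⟨(((Set.ext_iff.1 h) _).1 ⟨hab.1, hmem⟩).1, hab.2⟩
  -- dual-open edges between faces of the annulus are the same for `ω` and `ω'`
  have hedge : ∀ d : G.Dart, (emb.c (emb.leftFace d)).boxNorm ∈ Set.Icc ((r : ℝ) - 2) (R + 2) →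
      d.edge ∈ K := by
    intro d hd v hv
    have h1 := emb.abs_boxNorm_z_sub_boxNorm_c_le_one hiso d hv (Or.inl rfl)
    rw [abs_le] at h1
    rw [Set.mem_Icc] at hd ⊢
    exact ⟨by linarith [h1.1, hd.1], by linarith [h1.2, hd.2]⟩
  have hnot : ∀ d : G.Dart, (emb.c (emb.leftFace d)).boxNorm ∈ Set.Icc ((r : ℝ) - 2) (R + 2) →
      d.edge ∉ ω → d.edge ∉ ω' :=
    fun d hd hdω hdω' => hdω (((Set.ext_iff.1 h) _).2 ⟨hdω', hedge d hd⟩).1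
  have hadjD : ∀ ⦃φ ψ : F⦄, (emb.c φ).boxNorm ∈ Set.Icc ((r : ℝ) - 2) (R + 2) →
      (emb.c ψ).boxNorm ∈ Set.Icc ((r : ℝ) - 2) (R + 2) →
      (emb.dualOpenGraph ω).Adj φ ψ → (emb.dualOpenGraph ω').Adj φ ψ := by
    intro φ ψ hφ hψ hadj
    simp only [RhombicEmbedding.dualOpenGraph, SimpleGraph.fromRel_adj] at hadj ⊢
    obtain ⟨hne, hor⟩ := hadj
    refine ⟨hne, ?_⟩
    rcases hor with ⟨d, hl, hr, hd⟩ | ⟨d, hl, hr, hd⟩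
    · exact Or.inl ⟨d, hl, hr, hnot d (by rw [hl]; exact hφ) hd⟩
    · exact Or.inr ⟨d, hl, hr, hnot d (by rw [hl]; exact hψ) hd⟩
  -- transfer the primal arms (trivial walks for the other colour)
  have keyP : ∀ j, ∃ (y₁ : V) (q : (openGraph ω').Walk (x j) y₁),
      κ j = true → y₁ = y j ∧ q.support = (w j).support := by
    intro j
    by_cases hj : κ j = true
    · obtain ⟨-, -, hsupp⟩ := hprim j hj
      obtain ⟨q, hq⟩ := exists_walk_congr (H' := openGraph ω') (w j)
        (fun a b ha hb hab => hadjP (hsupp a ha) (hsupp b hb) hab)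
      exact ⟨y j, q, fun _ => ⟨rfl, hq⟩⟩
    · exact ⟨x j, SimpleGraph.Walk.nil, fun h' => absurd h' hj⟩
  choose y₁ q hq using keyP
  -- transfer the dual arms
  have keyD : ∀ j, ∃ (g₁ : F) (q' : (emb.dualOpenGraph ω').Walk (f j) g₁),
      κ j = false → g₁ = g j ∧ q'.support = (w' j).support := by
    intro j
    by_cases hj : κ j = false
    · obtain ⟨-, -, hsupp⟩ := hdual j hj
      obtain ⟨q', hq'⟩ := exists_walk_congr (H' := emb.dualOpenGraph ω') (w' j)
        (fun a b ha hb hab => hadjD (hsupp a ha) (hsupp b hb) hab)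
      exact ⟨g j, q', fun _ => ⟨rfl, hq'⟩⟩
    · exact ⟨f j, SimpleGraph.Walk.nil, fun h' => absurd h' hj⟩
  choose g₁ q' hq' using keyD
  refine ⟨x, y₁, q, f, g₁, q', fun j hj => ?_, fun j hj => ?_, fun i j hij hi hj => ?_,
    fun i j hij hi hj => ?_⟩
  · obtain ⟨hx, hy, hsupp⟩ := hprim j hj
    obtain ⟨hy₁, hqs⟩ := hq j hj
    refine ⟨hx, by rw [hy₁]; exact hy, fun v hv => hsupp v ?_⟩
    rw [← hqs]; exact hv
  · obtain ⟨hf, hg, hsupp⟩ := hdual j hj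
    obtain ⟨hg₁, hqs⟩ := hq' j hj
    refine ⟨hf, by rw [hg₁]; exact hg, fun v hv => hsupp v ?_⟩
    rw [← hqs]; exact hv
  · rw [(hq i hi).2, (hq j hj).2]
    exact hdisjP hij hi hj
  · rw [(hq' i hi).2, (hq' j hj).2]
    exact hdisjD hij hi hj

end Determined

/-! ### Measurability and independence over disjoint annuli -/

section Measure

variable {V F : Type*} {G : SimpleGraph V} (emb : RhombicEmbedding G F)

/-- **The arm events `A_κ(r, R)` are measurable**, every `κ`, for every graph of the class of
the fact (cylinder events of the finitely many pairs of vertices drawn in the shell: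
`determinedBy_embArmEvent`, `finite_setOf_boxNorm_z_le`, `DeterminedBy.measurableSet_of_finset`).
No countability of `V` or `F` is needed. (Grimmett 1999, §2.2.)
[cite: GrimmettManolescu2014Isoradial, §8.5.2 (locality of the arm events); Grimmett 1999 §2.2] -/
theorem _root_.Literature.Probability.LatticeModels.RhombicEmbedding.measurableSet_embArmEvent
    (hconn : G.Preconnected) (hiso : emb.IsIsoradial) (hrh : emb.IsRhombicTiling) {ε : ℝ}
    (hε : 0 < ε) (hbap : emb.HasBoundedAngles ε) {k : ℕ} (κ : Fin k → Bool) (r R : ℕ) :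
    MeasurableSet (emb.embArmEvent κ r R) := by
  classical
  set T : Finset V := (emb.finite_setOf_boxNorm_z_le hconn hiso hrh hε hbap (R + 3)).toFinset
    with hT
  refine DeterminedBy.measurableSet_of_finset (F := T.sym2)
    ((emb.determinedBy_embArmEvent hiso κ r R).mono (emb.shell_subset_sym2 fun v hv => ?_))
  rw [hT, Set.Finite.mem_toFinset, Set.mem_setOf_eq]
  exact hv.2

/-- **Independence of arm events of disjoint annuli**, any colour sequences. For `R₁ + 7 ≤ r₂`
the events `A_{κ₁}(r₁, R₁)` and `A_{κ₂}(r₂, R₂)` are independent under the canonical measure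
`P_G` of a graph of the class: they are determined by the disjoint shells
`{r₁ - 3 ≤ ‖·‖_∞ ≤ R₁ + 3}` and `{r₂ - 3 ≤ ‖·‖_∞ ≤ R₂ + 3}` of pairs of vertices, and `P_G`
is a product measure (`prodBernoulli_real_inter_of_determinedBy_disjoint`).
(Grimmett 1999, §2.2; Kesten 1987 / Nolin 2008 §3.4, independence of disjoint annuli;
Grimmett–Manolescu 2014, §8.5.2.) [cite: GrimmettManolescu2014Isoradial, §8.5.2 (events of disjoint regions); Grimmett 1999 §2.2] -/
theorem _root_.Literature.Probability.LatticeModels.RhombicEmbedding.isoradialPercolation_real_embArmEvent_inter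
    (hconn : G.Preconnected) (hiso : emb.IsIsoradial) (hrh : emb.IsRhombicTiling) {ε : ℝ}
    (hε : 0 < ε) (hbap : emb.HasBoundedAngles ε) {k₁ k₂ : ℕ} (κ₁ : Fin k₁ → Bool)
    (κ₂ : Fin k₂ → Bool) {r₁ R₁ r₂ R₂ : ℕ} (h : R₁ + 7 ≤ r₂) :
    emb.isoradialPercolation.real (emb.embArmEvent κ₁ r₁ R₁ ∩ emb.embArmEvent κ₂ r₂ R₂) =
      emb.isoradialPercolation.real (emb.embArmEvent κ₁ r₁ R₁) *
        emb.isoradialPercolation.real (emb.embArmEvent κ₂ r₂ R₂) := by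
  classical
  have hℝ : (R₁ : ℝ) + 7 ≤ r₂ := by exact_mod_cast h
  -- the two finite sets of vertices near the annuli
  have hfin₁ : {v : V | (emb.z v).boxNorm ∈ Set.Icc ((r₁ : ℝ) - 3) (R₁ + 3)}.Finite :=
    (emb.finite_setOf_boxNorm_z_le hconn hiso hrh hε hbap (R₁ + 3)).subset fun v hv => hv.2
  have hfin₂ : {v : V | (emb.z v).boxNorm ∈ Set.Icc ((r₂ : ℝ) - 3) (R₂ + 3)}.Finite :=
    (emb.finite_setOf_boxNorm_z_le hconn hiso hrh hε hbap (R₂ + 3)).subset fun v hv => hv.2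
  set T₁ : Finset V := hfin₁.toFinset with hT₁
  set T₂ : Finset V := hfin₂.toFinset with hT₂
  have hdisj : Disjoint T₁ T₂ := by
    rw [Finset.disjoint_left]
    intro v hv₁ hv₂
    rw [hT₁, Set.Finite.mem_toFinset, Set.mem_setOf_eq, Set.mem_Icc] at hv₁
    rw [hT₂, Set.Finite.mem_toFinset, Set.mem_setOf_eq, Set.mem_Icc] at hv₂
    linarith [hv₁.2, hv₂.1]
  have hdet₁ : DeterminedBy (emb.embArmEvent κ₁ r₁ R₁) (↑T₁.sym2 : Set (Sym2 V)) :=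
    (emb.determinedBy_embArmEvent hiso κ₁ r₁ R₁).mono (emb.shell_subset_sym2 fun v hv => by
      rw [hT₁, Set.Finite.mem_toFinset]; exact hv)
  have hdet₂ : DeterminedBy (emb.embArmEvent κ₂ r₂ R₂) (↑T₂.sym2 : Set (Sym2 V)) :=
    (emb.determinedBy_embArmEvent hiso κ₂ r₂ R₂).mono (emb.shell_subset_sym2 fun v hv => by
      rw [hT₂, Set.Finite.mem_toFinset]; exact hv)
  exact prodBernoulli_real_inter_of_determinedBy_disjoint emb.edgeWeight
    (IsoradialCriticality.disjoint_sym2_of_disjoint hdisj) hdet₁ hdet₂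
    (emb.measurableSet_embArmEvent hconn hiso hrh hε hbap κ₁ r₁ R₁)
    (emb.measurableSet_embArmEvent hconn hiso hrh hε hbap κ₂ r₂ R₂)

/-- **Sub-multiplicativity of the arm probabilities** (the elementary half of
quasi-multiplicativity), every colour sequence. For `r ≤ m`, `m + 7 ≤ m'` and `m' ≤ R`,
`P_G[A_κ(r, R)] ≤ P_G[A_κ(r, m)] · P_G[A_κ(m', R)]`: the arms of the big annulus contain arms of
the inner annulus `(r, m)` and of the outer annulus `(m', R)` (`embArmEvent_inter_subset_outer`,
`embArmEvent_inter_subset_inner`, up to the null set of configurations using non-edges of `G`),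
and the two smaller events are independent (`isoradialPercolation_real_embArmEvent_inter`).
(Kesten 1987; Nolin 2008, §3.4; Grimmett–Manolescu 2014, §8.3–8.5, where the comparisons
(exp_equiv) (a), (b) are "iterated" over scales.)
[cite: GrimmettManolescu2014Isoradial, §8.2 Prop. (exp_equiv) (a)–(b) (inclusions) with §8.5.2 (independence of disjoint regions)] -/
theorem _root_.Literature.Probability.LatticeModels.RhombicEmbedding.embArmProb_submult
    [Countable V] (hconn : G.Preconnected) (hiso : emb.IsIsoradial) (hrh : emb.IsRhombicTiling)
    {ε : ℝ} (hε : 0 < ε) (hbap : emb.HasBoundedAngles ε) {k : ℕ} (κ : Fin k → Bool)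
    {r m m' R : ℕ} (hrm : r ≤ m) (hmm' : m + 7 ≤ m') (hm'R : m' ≤ R) :
    emb.embArmProb κ r R ≤ emb.embArmProb κ r m * emb.embArmProb κ m' R := by
  have hmR : m ≤ R := by omega
  have hrm' : r ≤ m' := by omega
  have hsub : emb.embArmEvent κ r R ∩ {ω | ω ⊆ G.edgeSet} ⊆
      emb.embArmEvent κ r m ∩ emb.embArmEvent κ m' R := fun ω hω =>
    ⟨emb.embArmEvent_inter_subset_outer hiso κ hrm hmR hω,
      emb.embArmEvent_inter_subset_inner hiso κ hrm' hm'R hω⟩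
  calc emb.embArmProb κ r R
      ≤ emb.isoradialPercolation.real (emb.embArmEvent κ r m ∩ emb.embArmEvent κ m' R) :=
        emb.real_le_real_of_inter_subset hsub
    _ = emb.embArmProb κ r m * emb.embArmProb κ m' R :=
        emb.isoradialPercolation_real_embArmEvent_inter hconn hiso hrh hε hbap κ κ hmm'

end Measure

end Literature.Probability.Percolation
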